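/-
Copyright (c) 2026. All rights reserved.
Released under Apache 2.0 license as described in the file LICENSE.
Authors: abc-iut cell, seat abc-iut-w6-d025 (gen 2; block C / W6, row «Cor36-LOGOBS-TELE»).
-/
import Literature.AnabelianGeometry.AbsoluteAnabelian.AbsTopIII.FrobeniusPictureMLFTelecoreOverE
import Literature.AnabelianGeometry.AbsoluteAnabelian.AbsTopIII.FrobeniusPictureMLFLogTeleBoundary
import Literature.AnabelianGeometry.AbsoluteAnabelian.DiagramOverHomotopies
import Literature.AnabelianGeometry.AbsoluteAnabelian.DiagramComap

/-!
# [AbsTopIII] Cor. 3.6 (iii), second clause, telecore half: the homotopies of the glued family on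
# `𝒟_An` (by the canonical split), all lying over `ℰ`

S. Mochizuki, *Topics in Absolute Anabelian Geometry III*, Cor. 3.6 (iii) p. 80 of the kurims
manuscript (`paper:url-5493eb38cbb7`; bib key `MochizukiAbsTopIII2015`); proof p. 81: "immediate from
the definitions — i.e., in essence, because the various Galois groups that appear remain
'undisturbed'".  Continuation of `FrobeniusPictureMLFLogTeleBoundary.lean` (the glued boundary set
`TGlueE` on the telecore diagram `𝒟_An`, by the canonical split at the last visit to `Anab`) and
`FrobeniusPictureMLFTelecoreOverE.lean` (the structure functors of `𝒟_An` over `ℰ`, fully faithful at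
`Anab`).  Given a family of homotopies `G₁` on the telecore-free sub-diagram `jS^*𝒟_An` (the family
realising the cores and `𝔖_log`, pulled back) this file defines the HOMOTOPY of a decomposed pair
(`TDec.η`): the tail homotopy of `G₁` for a telecore-free pair (`tailη`), the lift through
`Anab → ℰ` for a pair into `Anab`, and for a split pair `([γ₁]·φ_⋏·u, [γ₂]·φ_⋏·v)` the lift of the
prefix pair whiskered along the tail followed by the tail homotopy whiskered along the prefix —
written as a composite of the canonical whiskered forms of `DiagramOverHomotopies.lean`, so that
**every such homotopy lies over `ℰ`** (`TDec.η_isOver`) as soon as the tail homotopies of `G₁` do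
(hypothesis `hover`: "the Galois groups remain undisturbed").  The homotopy does not depend on the
decomposition (`TDec.η_eq`, by the uniqueness of the canonical split) and is the identity on a
diagonal pair (`TDec.η_self`).  The family axioms and the theorem follow in the next file.  Pure
category theory; nothing here takes a side on inter-universal Teichmüller theory or bears on
[IUTchIII] Cor. 3.12.
-/

namespace Literature.AnabelianGeometry.AbsoluteAnabelian

open _root_.CategoryTheory _root_.Quiver

universe u

namespace LogFrobeniusData

open DiagramOfCategories

variable (Δ : LogFrobeniusData.{u}) (τ : Δ.TelecoreData)
variable (G₁ : ((Δ.teleDiagram anJ (Δ.anTelMap τ)).comapAlong jS.{u}).HomotopyFamily)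

/-! ### The tail homotopies -/

/-- **The tail homotopy** of a telecore-free pair: the homotopy of `G₁` re-typed on the path functors
of `𝒟_An` (`(jS^*𝒟_An)_{[u]} = (𝒟_An)_{jS u}`). [cite: MochizukiAbsTopIII2015, Corollary 3.6 (iii) p.80] -/
noncomputable def tailη {x y : FVtx.{u}} {u v : Path x y} (h : G₁.E u v) :
    (Δ.teleDiagram anJ (Δ.anTelMap τ)).pathFunctor (jS.mapPath u) ⟶
      (Δ.teleDiagram anJ (Δ.anTelMap τ)).pathFunctor (jS.mapPath v) :=
  eqToHom ((Δ.teleDiagram anJ (Δ.anTelMap τ)).pathFunctor_comapAlong jS u).symm ≫ G₁.η h ≫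
    eqToHom ((Δ.teleDiagram anJ (Δ.anTelMap τ)).pathFunctor_comapAlong jS v)

/-- The tail homotopy is (heterogeneously) the homotopy of `G₁`. [cite: MochizukiAbsTopIII2015, Corollary 3.6 (iii) p.80] -/
theorem tailη_heq {x y : FVtx.{u}} {u v : Path x y} (h : G₁.E u v) :
    HEq (Δ.tailη τ G₁ h) (G₁.η h) :=
  HomotopyFamily.heq_eqToHom_comp_comp_eqToHom _ _ _

/-- The tail homotopy of a diagonal pair is the identity. [cite: MochizukiAbsTopIII2015, Definition 3.5 (ii) p.75] -/
theorem tailη_refl {x y : FVtx.{u}} {u : Path x y} (h : G₁.E u u) : Δ.tailη τ G₁ h = 𝟙 _ := by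
  rw [tailη, G₁.η_refl h, Category.id_comp, eqToHom_trans, eqToHom_refl]

/-- The tail homotopies compose. [cite: MochizukiAbsTopIII2015, Definition 3.5 (ii) p.75] -/
theorem tailη_trans {x y : FVtx.{u}} {u v w : Path x y} (h₁ : G₁.E u v) (h₂ : G₁.E v w) :
    Δ.tailη τ G₁ (G₁.isSaturated.trans h₁ h₂) = Δ.tailη τ G₁ h₁ ≫ Δ.tailη τ G₁ h₂ := by
  simp only [tailη, G₁.η_trans h₁ h₂, Category.assoc, eqToHom_trans_assoc, eqToHom_refl,
    Category.id_comp]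

/-- The tail homotopy of a pair whose components are "equal or `G₁`-related": the tail homotopy
if related, the identity (an `eqToHom`) if equal — the two agree when both hold (`tailη_refl`).
[cite: MochizukiAbsTopIII2015, Corollary 3.6 (iii) p.80] -/
noncomputable def θtail {x y : FVtx.{u}} (u v : Path x y) (huv : u = v ∨ G₁.E u v) :
    (Δ.teleDiagram anJ (Δ.anTelMap τ)).pathFunctor (jS.mapPath u) ⟶
      (Δ.teleDiagram anJ (Δ.anTelMap τ)).pathFunctor (jS.mapPath v) := by
  classical
  exact if h : G₁.E u v then Δ.tailη τ G₁ h else eqToHom (by rw [huv.resolve_right h])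

/-- `θtail` on a `G₁`-related pair is the tail homotopy. [cite: MochizukiAbsTopIII2015, Corollary 3.6 (iii) p.80] -/
theorem θtail_of_E {x y : FVtx.{u}} {u v : Path x y} (huv : u = v ∨ G₁.E u v) (h : G₁.E u v) :
    Δ.θtail τ G₁ u v huv = Δ.tailη τ G₁ h := by
  classical
  exact dif_pos h

/-- `θtail` on a diagonal pair is the identity. [cite: MochizukiAbsTopIII2015, Definition 3.5 (ii) p.75] -/
theorem θtail_self {x y : FVtx.{u}} (u : Path x y) (huu : u = u ∨ G₁.E u u) :
    Δ.θtail τ G₁ u u huu = 𝟙 _ := by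
  classical
  by_cases h : G₁.E u u
  · rw [θtail_of_E _ _ _ huu h, tailη_refl]
  · exact (dif_neg h).trans (eqToHom_refl _ _)

/-! ### Decompositions of glued pairs and their homotopies -/

/-- The tail `φ_⋏ · jS u` out of `Anab` of a split path. [cite: MochizukiAbsTopIII2015, Definition 3.5 (iv) p.76] -/
def tailPath {γ β : SubVertex {a : LFVertex | a.row ≤ 4}} (j : anJ.{u} γ)
    (u : Path (⟨(teleShape anJ.{u}).base γ⟩ : FVtx.{u}) ⟨(teleShape anJ.{u}).base β⟩) :
    Path (teleShape anJ.{u}).obs ((teleShape anJ.{u}).base β) :=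
  ((Path.nil : Path (teleShape anJ.{u}).obs (teleShape anJ.{u}).obs).cons (phiEdge j)).comp (jS.mapPath u)

/-- A split path is its prefix followed by its tail. [cite: MochizukiAbsTopIII2015, Definition 3.5 (iv) p.76] -/
theorem split_eq_comp_tailPath {a : (teleShape anJ.{u}).Vertex} {γ β : SubVertex {a : LFVertex | a.row ≤ 4}}
    (p : Path a (teleShape anJ.{u}).obs) (j : anJ.{u} γ)
    (u : Path (⟨(teleShape anJ.{u}).base γ⟩ : FVtx.{u}) ⟨(teleShape anJ.{u}).base β⟩) :
    (p.cons (phiEdge j)).comp (jS.mapPath u) = p.comp (tailPath j u) :=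
  Path.comp_assoc p ((Path.nil : Path (teleShape anJ.{u}).obs (teleShape anJ.{u}).obs).cons (phiEdge j))
    (jS.mapPath u)

/-- **A decomposition of a glued pair** (the data of a `TGlueE`-constructor): a telecore-free pair
between vertices of `𝒟_{≤4}` related by `G₁`, a pair into `Anab`, or a split pair with tails equal or
`G₁`-related. [cite: MochizukiAbsTopIII2015, Corollary 3.6 (iii) p.80] -/
inductive TDec : ∀ {a b : (teleShape anJ.{u}).Vertex}, Path a b → Path a b → Type u
  | free {α β : SubVertex {a : LFVertex | a.row ≤ 4}}
      (u v : Path (⟨(teleShape anJ.{u}).base α⟩ : FVtx.{u}) ⟨(teleShape anJ.{u}).base β⟩)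
      (h : G₁.E u v) : TDec (jS.mapPath u) (jS.mapPath v)
  | obs {a : (teleShape anJ.{u}).Vertex} (p q : Path a (teleShape anJ.{u}).obs) : TDec p q
  | tele {a : (teleShape anJ.{u}).Vertex} {γ β : SubVertex {a : LFVertex | a.row ≤ 4}}
      (p q : Path a (teleShape anJ.{u}).obs) (j : anJ.{u} γ)
      (u v : Path (⟨(teleShape anJ.{u}).base γ⟩ : FVtx.{u}) ⟨(teleShape anJ.{u}).base β⟩)
      (huv : u = v ∨ G₁.E u v) :
      TDec ((p.cons (phiEdge j)).comp (jS.mapPath u)) ((q.cons (phiEdge j)).comp (jS.mapPath v))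

/-- A decomposed pair is glued. [cite: MochizukiAbsTopIII2015, Corollary 3.6 (iii) p.80] -/
theorem TDec.tGlueE {a b : (teleShape anJ.{u}).Vertex} {P Q : Path a b} :
    Δ.TDec τ G₁ P Q → TGlueE G₁.E P Q
  | .free _ _ h => TGlueE.free h
  | .obs p q => TGlueE.obs p q
  | .tele p q j _ _ huv => TGlueE.tele p q j huv

/-- A glued pair admits a decomposition. [cite: MochizukiAbsTopIII2015, Corollary 3.6 (iii) p.80] -/
theorem nonempty_tDec {a b : (teleShape anJ.{u}).Vertex} {P Q : Path a b} (h : TGlueE G₁.E P Q) :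
    Nonempty (Δ.TDec τ G₁ P Q) := by
  cases h with
  | free h => exact ⟨TDec.free _ _ h⟩
  | obs p q => exact ⟨TDec.obs p q⟩
  | tele p q j huv => exact ⟨TDec.tele p q j _ _ huv⟩

/-- The lift through `Anab → ℰ` of a pair into `Anab`, whiskered along a tail `σ` out of `Anab` — in
the canonical whiskered form. [cite: MochizukiAbsTopIII2015, Definition 3.5 (iv) p.76] -/
noncomputable def liftTail {a b : (teleShape anJ.{u}).Vertex} (p q : Path a (teleShape anJ.{u}).obs)
    (s : Path (teleShape anJ.{u}).obs b) :
    (Δ.teleDiagram anJ (Δ.anTelMap τ)).pathFunctor (p.comp s) ⟶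
      (Δ.teleDiagram anJ (Δ.anTelMap τ)).pathFunctor (q.comp s) :=
  eqToHom ((Δ.teleDiagram anJ (Δ.anTelMap τ)).pathFunctor_comp p s) ≫
    Functor.whiskerRight ((Δ.teleOverE τ).lift (Δ.anFFE τ _ rfl) p q)
      ((Δ.teleDiagram anJ (Δ.anTelMap τ)).pathFunctor s) ≫
    eqToHom ((Δ.teleDiagram anJ (Δ.anTelMap τ)).pathFunctor_comp q s).symm

/-- `liftTail` lies over `ℰ`. [cite: MochizukiAbsTopIII2015, Corollary 3.6 (iii) p.81] -/
theorem liftTail_isOver {a b : (teleShape anJ.{u}).Vertex} (p q : Path a (teleShape anJ.{u}).obs)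
    (s : Path (teleShape anJ.{u}).obs b) :
    (Δ.teleOverE τ).IsOver (p.comp s) (q.comp s) (Δ.liftTail τ p q s) :=
  (OverData.isOver_lift (Δ.anFFE τ _ rfl) p q).whiskerRight s

/-- A homotopy of tails, whiskered along a common prefix `[ρ]` — in the canonical whiskered form.
[cite: MochizukiAbsTopIII2015, Definition 3.5 (ii) p.75] -/
noncomputable def preWhisker {c a b : (teleShape anJ.{u}).Vertex} (r : Path c a) {P Q : Path a b}
    (θ : (Δ.teleDiagram anJ (Δ.anTelMap τ)).pathFunctor P ⟶ (Δ.teleDiagram anJ (Δ.anTelMap τ)).pathFunctor Q) :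
    (Δ.teleDiagram anJ (Δ.anTelMap τ)).pathFunctor (r.comp P) ⟶
      (Δ.teleDiagram anJ (Δ.anTelMap τ)).pathFunctor (r.comp Q) :=
  eqToHom ((Δ.teleDiagram anJ (Δ.anTelMap τ)).pathFunctor_comp r P) ≫
    Functor.whiskerLeft ((Δ.teleDiagram anJ (Δ.anTelMap τ)).pathFunctor r) θ ≫
    eqToHom ((Δ.teleDiagram anJ (Δ.anTelMap τ)).pathFunctor_comp r Q).symm

/-- `preWhisker` preserves over-ness. [cite: MochizukiAbsTopIII2015, Corollary 3.6 (iii) p.81] -/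
theorem preWhisker_isOver {c a b : (teleShape anJ.{u}).Vertex} (r : Path c a) {P Q : Path a b}
    {θ : (Δ.teleDiagram anJ (Δ.anTelMap τ)).pathFunctor P ⟶ (Δ.teleDiagram anJ (Δ.anTelMap τ)).pathFunctor Q}
    (h : (Δ.teleOverE τ).IsOver P Q θ) :
    (Δ.teleOverE τ).IsOver (r.comp P) (r.comp Q) (Δ.preWhisker τ r θ) :=
  h.whiskerLeft r

/-- **The homotopy of a decomposed pair**: the tail homotopy (`free`), the lift through `Anab → ℰ`
(`obs`), or — for a split pair — the lift of the prefix pair whiskered along the left tail followed by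
the tail homotopy whiskered along the right prefix (`tele`).
[cite: MochizukiAbsTopIII2015, Corollary 3.6 (iii) p.80] -/
noncomputable def TDec.η {a b : (teleShape anJ.{u}).Vertex} {P Q : Path a b} :
    Δ.TDec τ G₁ P Q →
      ((Δ.teleDiagram anJ (Δ.anTelMap τ)).pathFunctor P ⟶ (Δ.teleDiagram anJ (Δ.anTelMap τ)).pathFunctor Q)
  | .free _ _ h => Δ.tailη τ G₁ h
  | .obs p q => (Δ.teleOverE τ).lift (Δ.anFFE τ _ rfl) p q
  | .tele p q j u v huv =>
    eqToHom (congrArg (Δ.teleDiagram anJ (Δ.anTelMap τ)).pathFunctor (split_eq_comp_tailPath p j u)) ≫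
      Δ.liftTail τ p q (tailPath j u) ≫
      eqToHom (congrArg (Δ.teleDiagram anJ (Δ.anTelMap τ)).pathFunctor
        (split_eq_comp_tailPath q j u)).symm ≫
      Δ.preWhisker τ (q.cons (phiEdge j)) (Δ.θtail τ G₁ u v huv)

section Over

variable (hover : ∀ ⦃x y : FVtx.{u}⦄ ⦃u v : Path x y⦄ (h : G₁.E u v),
  (Δ.teleOverE τ).IsOver (jS.mapPath u) (jS.mapPath v) (Δ.tailη τ G₁ h))
include hover

/-- The tail homotopies `θtail` lie over `ℰ` (given `hover`). [cite: MochizukiAbsTopIII2015, Corollary 3.6 (iii) p.81] -/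
theorem θtail_isOver {x y : FVtx.{u}} (u v : Path x y) (huv : u = v ∨ G₁.E u v) :
    (Δ.teleOverE τ).IsOver (jS.mapPath u) (jS.mapPath v) (Δ.θtail τ G₁ u v huv) := by
  classical
  by_cases h : G₁.E u v
  · rw [θtail_of_E _ _ _ huv h]
    exact hover h
  · obtain rfl := huv.resolve_right h
    rw [θtail_self]
    exact OverData.isOver_id _

/-- **Every homotopy of a decomposed pair lies over `ℰ`** ("the Galois groups remain undisturbed").
[cite: MochizukiAbsTopIII2015, Corollary 3.6 (iii) p.81] -/
theorem TDec.η_isOver {a b : (teleShape anJ.{u}).Vertex} {P Q : Path a b} :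
    ∀ d : Δ.TDec τ G₁ P Q, (Δ.teleOverE τ).IsOver P Q d.η
  | .free _ _ h => hover h
  | .obs p q => OverData.isOver_lift _ p q
  | .tele p q j u v huv => by
    have h₁ := (Δ.liftTail_isOver τ p q (tailPath j u)).congr (split_eq_comp_tailPath p j u).symm
      (split_eq_comp_tailPath q j u).symm
    have h₂ := Δ.preWhisker_isOver τ (q.cons (phiEdge j)) (Δ.θtail_isOver τ G₁ hover u v huv)
    have h₃ := h₁.comp h₂
    simp only [Category.assoc] at h₃
    exact h₃

end Over

/-! ### The homotopy does not depend on the decomposition -/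

/-- Inversion of a decomposition of a pair into a vertex of `𝒟_{≤4}`: it is `free` or `tele`, with the
displayed data (bookkeeping). [cite: MochizukiAbsTopIII2015, Corollary 3.6 (iii) p.80] -/
theorem TDec.inv_base {a : (teleShape anJ.{u}).Vertex} {β : SubVertex {a : LFVertex | a.row ≤ 4}}
    {P Q : Path a ((teleShape anJ.{u}).base β)} (d : Δ.TDec τ G₁ P Q) :
    (∃ (α : SubVertex {a : LFVertex | a.row ≤ 4}) (_ : a = (teleShape anJ.{u}).base α)
        (u v : Path (⟨(teleShape anJ.{u}).base α⟩ : FVtx.{u}) ⟨(teleShape anJ.{u}).base β⟩)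
        (h : G₁.E u v), HEq P (jS.mapPath u) ∧ HEq Q (jS.mapPath v) ∧ HEq d.η (Δ.tailη τ G₁ h)) ∨
      ∃ (γ : SubVertex {a : LFVertex | a.row ≤ 4}) (p q : Path a (teleShape anJ.{u}).obs) (j : anJ.{u} γ)
        (u v : Path (⟨(teleShape anJ.{u}).base γ⟩ : FVtx.{u}) ⟨(teleShape anJ.{u}).base β⟩)
        (huv : u = v ∨ G₁.E u v) (hP : P = (p.cons (phiEdge j)).comp (jS.mapPath u))
        (hQ : Q = (q.cons (phiEdge j)).comp (jS.mapPath v)),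
        d.η = eqToHom (congrArg (Δ.teleDiagram anJ (Δ.anTelMap τ)).pathFunctor hP) ≫
          (TDec.tele p q j u v huv : Δ.TDec τ G₁ _ _).η ≫
            eqToHom (congrArg (Δ.teleDiagram anJ (Δ.anTelMap τ)).pathFunctor hQ).symm := by
  cases d with
  | free u v h => exact Or.inl ⟨_, rfl, u, v, h, HEq.rfl, HEq.rfl, HEq.rfl⟩
  | tele p q j u v huv =>
    exact Or.inr ⟨_, p, q, j, u, v, huv, rfl, rfl, by simp⟩

/-- Inversion of a decomposition of a pair into `Anab`: it is `obs` (bookkeeping).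
[cite: MochizukiAbsTopIII2015, Corollary 3.6 (iii) p.80] -/
theorem TDec.inv_obs {a : (teleShape anJ.{u}).Vertex} {P Q : Path a (teleShape anJ.{u}).obs}
    (d : Δ.TDec τ G₁ P Q) : d.η = (Δ.teleOverE τ).lift (Δ.anFFE τ _ rfl) P Q := by
  cases d with
  | obs p q => rfl

/-- Choice-independence for pairs into a vertex of `𝒟_{≤4}`. [cite: MochizukiAbsTopIII2015, Corollary 3.6 (iii) p.80] -/
theorem TDec.η_eq_base {a : (teleShape anJ.{u}).Vertex} {β : SubVertex {a : LFVertex | a.row ≤ 4}}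
    {P Q : Path a ((teleShape anJ.{u}).base β)} (d d' : Δ.TDec τ G₁ P Q) : d.η = d'.η := by
  rcases d.inv_base with ⟨α, ha, u, v, h, hP, hQ, hη⟩ | ⟨γ, p, q, j, u, v, huv, hP, hQ, hη⟩
  · subst ha
    cases hP; cases hQ
    rcases d'.inv_base with ⟨α', ha', u', v', h', hP', hQ', hη'⟩ |
      ⟨γ', p', q', j', u', v', huv', hP', hQ', hη'⟩
    · cases ha'
      obtain rfl := jS_mapPath_injective _ _ (eq_of_heq hP')
      obtain rfl := jS_mapPath_injective _ _ (eq_of_heq hQ')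
      exact eq_of_heq (hη.trans hη'.symm)
    · exact absurd hP' (jS_mapPath_ne_tele _ _ _ _)
  · subst hP; subst hQ
    rcases d'.inv_base with ⟨α', ha', u', v', h', hP', hQ', hη'⟩ |
      ⟨γ', p', q', j', u', v', huv', hP', hQ', hη'⟩
    · cases ha'
      exact absurd (eq_of_heq hP').symm (jS_mapPath_ne_tele _ _ _ _)
    · obtain ⟨hγ, rfl, hj, hu⟩ := tele_decomp_unique _ _ _ _ _ _ hP'
      cases hγ; cases hj; cases hu
      obtain ⟨-, rfl, -, hv⟩ := tele_decomp_unique _ _ _ _ _ _ hQ'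
      cases hv
      exact hη.trans hη'.symm

/-- **The homotopy of a glued pair does not depend on the chosen decomposition** (the canonical
split is unique: `jS_mapPath_injective`, `tele_decomp_unique`, `jS_mapPath_ne_tele`).
[cite: MochizukiAbsTopIII2015, Corollary 3.6 (iii) p.80] -/
theorem TDec.η_eq {a b : (teleShape anJ.{u}).Vertex} {P Q : Path a b} (d d' : Δ.TDec τ G₁ P Q) :
    d.η = d'.η := by
  cases b with
  | obs => exact d.inv_obs.trans d'.inv_obs.symm
  | base β => exact TDec.η_eq_base Δ τ G₁ d d'

/-- `liftTail` of a diagonal prefix pair is the identity. [cite: MochizukiAbsTopIII2015, Definition 3.5 (ii) p.75] -/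
theorem liftTail_self {a b : (teleShape anJ.{u}).Vertex} (p : Path a (teleShape anJ.{u}).obs)
    (s : Path (teleShape anJ.{u}).obs b) : Δ.liftTail τ p p s = 𝟙 _ := by
  rw [liftTail, OverData.lift_self, Functor.whiskerRight_id', Category.id_comp, eqToHom_trans,
    eqToHom_refl]

/-- `preWhisker` of an identity is the identity. [cite: MochizukiAbsTopIII2015, Definition 3.5 (ii) p.75] -/
theorem preWhisker_id {c a b : (teleShape anJ.{u}).Vertex} (r : Path c a) (P : Path a b) :
    Δ.preWhisker τ r (𝟙 ((Δ.teleDiagram anJ (Δ.anTelMap τ)).pathFunctor P)) = 𝟙 _ := by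
  rw [preWhisker, Functor.whiskerLeft_id', Category.id_comp, eqToHom_trans, eqToHom_refl]

/-- The homotopy of the diagonal split pair is the identity. [cite: MochizukiAbsTopIII2015, Definition 3.5 (ii) p.75] -/
theorem TDec.η_tele_self {a : (teleShape anJ.{u}).Vertex} {γ β : SubVertex {a : LFVertex | a.row ≤ 4}}
    (p : Path a (teleShape anJ.{u}).obs) (j : anJ.{u} γ)
    (u : Path (⟨(teleShape anJ.{u}).base γ⟩ : FVtx.{u}) ⟨(teleShape anJ.{u}).base β⟩)
    (huu : u = u ∨ G₁.E u u) :
    (TDec.tele p p j u u huu : Δ.TDec τ G₁ _ _).η = 𝟙 _ := by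
  show eqToHom _ ≫ Δ.liftTail τ p p (tailPath j u) ≫ eqToHom _ ≫
    Δ.preWhisker τ (p.cons (phiEdge j)) (Δ.θtail τ G₁ u u huu) = 𝟙 _
  rw [liftTail_self, θtail_self, preWhisker_id]
  simp

/-- Choice-free identity on a diagonal pair into a vertex of `𝒟_{≤4}`. [cite: MochizukiAbsTopIII2015, Definition 3.5 (ii) p.75] -/
theorem TDec.η_self_base {a : (teleShape anJ.{u}).Vertex} {β : SubVertex {a : LFVertex | a.row ≤ 4}}
    {P : Path a ((teleShape anJ.{u}).base β)} (d : Δ.TDec τ G₁ P P) : d.η = 𝟙 _ := by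
  rcases d.inv_base with ⟨α, ha, u, v, h, hP, hQ, hη⟩ | ⟨γ, p, q, j, u, v, huv, hP, hQ, hη⟩
  · subst ha
    cases hP
    obtain rfl := jS_mapPath_injective _ _ (eq_of_heq hQ)
    exact (eq_of_heq hη).trans (Δ.tailη_refl τ G₁ h)
  · subst hP
    obtain ⟨-, rfl, -, hu⟩ := tele_decomp_unique _ _ _ _ _ _ hQ
    cases hu
    rw [TDec.η_tele_self] at hη
    simpa using hη

/-- **The homotopy of a diagonal pair is the identity** (Def. 3.5 (ii): `ζ_{([γ],[γ])} = id`).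
[cite: MochizukiAbsTopIII2015, Definition 3.5 (ii) p.75] -/
theorem TDec.η_self {a b : (teleShape anJ.{u}).Vertex} {P : Path a b} (d : Δ.TDec τ G₁ P P) :
    d.η = 𝟙 _ := by
  cases b with
  | obs => exact d.inv_obs.trans (OverData.lift_self _ _ _)
  | base β => exact TDec.η_self_base Δ τ G₁ d

end LogFrobeniusData

end Literature.AnabelianGeometry.AbsoluteAnabelian
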